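import Summits.BirchSwinnertonDyer.Rank1Residual.O6.TowerInterfaces
import Summits.BirchSwinnertonDyer.Rank1Residual.Additive.PotSupersingularClasses
import Summits.BirchSwinnertonDyer.Rank1Residual.Additive.FouquetWanLocus
import HarnessLib

/-!
# BSD rank-≤1 residual cell, class O6 (WILD `p = 3`), Iwasawa side: the SIGNED KATO-LOCAL FLOOR — T-O6-G12
# (interface `SignedFloorDatum`, the cell table `p(v₃N, Kod₃)`, and the local laws (M) MODULE STRUCTURE,
# (Λ) SHAPE / TORSION, (IRR) PAIR, (TW) TWIST COVARIANCE, (CAN) canonical subgroup — TYPED, EVIDENCE-LABELLED,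
# NOTHING ASSERTED; the analytic laws (A) (B) (AN) are in the sibling `O6/KatoLocalFloorAnalytic.lean`)

HONEST FRAMING (cell `b2b-bsdres`, run/shared/lean/b2b/bsd-rank1-residual/, verbatim in every file): the goal of
the cell is to DELETE the COMBINATION-SHAPED residual classes of the Birch–Swinnerton-Dyer formula for ALL
analytic-rank `≤ 1` elliptic curves over `ℚ` — assembled STRICTLY from published theorems — so that the rank-`≤ 1`
remainder becomes exactly the CONSTRUCTION-SHAPED classes, which are TYPED (missing-input `Prop`s), NOT attempted.
This is not "finishing BSD". Lane CLASS-CLOSURE (`CLASS-CLOSURE-PLAN.md` §3.4 O6, deliverable (a) STATEMENT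
DISCOVERY with HELD-OUT validation): research routes; no claim beyond the stated classes; census output is
EVIDENCE / conjecture items, never a Literature fact; no main conjecture, no `p`-adic `L`-function, no Coleman map is
assumed; nothing is booked; no mark of `RESIDUAL-MAP.md` moves; O6 stays OPEN. Closed unproved `def : Prop` nodes
carry `@[conjecture]` whatever the docstring grade (cc-lead ⟦gen22⟧ (8)(b)). 0 Literature facts are minted here.

## What is typed (cc-typer-5 GEN 10 = O5/O6 typer of record; ask of o6-r1 GEN 12, `HOME/INBOX.md`
## 2026-08-21T19:43:40Z "item (iv) schema READY"; content = o6-r1's memo of record `HOME/b2b-bsdres-o6-r1/gen12/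
## O6-GEN12.md` (sha16 `b74dc3c6d65d6ac1`) §1–§5, LATE addendum `gen12/G12-LATE.md` (L1, L3) and the elaborating
## schema offers `gen12/lean/O6KatoLocalFloorG12.lean` (`47853d9596029398`) / `…G12b.lean` (`088c0a53b9faee08`);
## placement / names / interface shape / dedup = class typer)

SETTING (memo header). `W ∈ O6` (`ClassO6 W 3`: additive at `3`, potentially good, `v₃(N) ∈ {3, 4, 5}`), cells
`(v₃N, Kod₃) ∈ {3,4,5} × {II, IV, IV*, II*}` (classes A / B / C); `K_k := ℚ₃(μ_{3^{k+1}})`, `F_{k−1} := ℚ₃(μ_{3^k})`,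
`φ_k := φ(3^k) = 2·3^{k−1}`; `L_k(W) := log_ω(W(K_k) ⊗ ℤ₃) ⊂ K_k` the LOG LATTICE; `χ_s` primitive of conductor
`3^{k+1}` with `χ_s(−1) = s`; `Λ^s_k(W) := L_k ∩ K_k^{new,s}` the SIGNED TRACE-FREE log lattice, a rank-one module
over the DVR `𝒪_χ = ℤ₃[μ_{3^k}]`, hence `= ϖ^{n} · 𝒪^{new,s}` for an integer **position** `n = n^s_k(W)`; the SHARP
KATO-LOCAL FLOOR `𝔪^s_k(W) := (k+1)/2 + min_{x ∈ L_k^*} v₃(R_{χ_s}(x))`. **THEOREM S1 (memo §1, proved there for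
every `G`-stable lattice and unit-tested exactly at `k = 1, 2`): `𝔪^s_k(W) = ½ − n^s_k(W)/φ(3^k)`** — recorded below
as the DEFINITION `floorOf n k` of the floor from the position (o6-r1: "recorded only as the definition"), so the
free integrality S4 `φ(3^k)(½ − 𝔪) ∈ ℤ` is the type of `n`.

* §1 PURE ARITHMETIC (decidable, values PROVED): `phiThree k = 2·3^{k−1}`; the NEW-POLE ORDER table
  `newPoleOrder (v₃N) (Kod₃) ∈ {0, 1/6, 1/3, 1/2, 2/3, 5/6}` (memo §2: `(3,II) 0 (3,IV) 0 (3,IV*) ½ (3,II*) ½ · (4,II) 0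
  (4,IV) ⅓ (4,IV*) ½ (4,II*) ⅚ · (5,II) ⅙ (5,IV) ⅓ (5,IV*) ⅔ (5,II*) ⅚`), the level `cellLevel = ½ + p`, its
  TWIST-COVARIANCE `p(cell*) = p(cell) + ½` (the DERIVED half, L3) and its agreement with GEN 3's `kodairaOffset` on
  the cyclic class B; `floorOf n k = ½ − n/φ_k`, `lamOf f K n k = −(n + φ_k·p)` (`= φ_k·(𝔪 − ℓ)`, proved) and its
  integrality for `k ≥ 2` (proved); `irrFloor k = ⌊(3^{k−1} − 1)/4⌋ = 0, 0, 2, 6, 20, 60`.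
* §2 INTERFACE `SignedFloorDatum W` (definition request D-O6-KF; fields NAME data Lean cannot yet define: the
  position `pos k s = n^s_k(W)`, the analytic valuation `nu k s = ν^s_k(W)` (`v₃` of the `χ_s`-part of the Mazur–Tate
  element `θ_{k+1}(W)`; `none` iff it vanishes), Kato's constant `katoConst = v₃(c_W)`, the SHAPE of `W[3]|G_{ℚ₃}`
  (`LocalShapeThree`: ET1 / ETM / ORD1 / ORDM / SPLIT / IRR, o6-r1 gen 10), the `K_k`-rational 3-power torsion
  `torsThree k = v₃ #W(K_k)[3^∞]`), an interface predicate `real W D` ("`D` is THE datum of `W`", a section variable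
  as for `TowerValuation`), its CONSTRUCTION shape, and the tree-vocabulary compatibility predicate
  `ReadsLocIrr : D.shape = IRR ↔ LocIrr W 3` (the Fouquet–Wan bit of `Additive/FouquetWanLocus.lean`).
* §3 THE LOCAL LAWS as `@[conjecture]` nodes over `real` (EVIDENCE blocks verbatim from the memo; P-KF4 HELD-OUT =
  PASS, 0 exceptions / 480 rows under TWO pre-registrations frozen before the run): (M) `ModuleStructureLawThree`,
  (Λ) `ShapeTorsionLawThree`, (IRR) `IrrPairLawThree`, (TW) `TwistCovarianceLawThree`; and (CAN) `LocIrrThreeJInvariant`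
  (L1: `LocIrr W 3 → v₃(j) = 3` on O6 — THEOREM-CANDIDATE, Katz–Lubin canonical subgroup; no datum needed).
  TYPER DECISIONS: (i) (M)'s bound `λ ∈ [−1, 2]` is typed for the NON-IRR shapes only, as memo §5 (M) prints it
  ("λ(IRR) governed by (IRR)") — the schema offer's unrestricted form contradicts its own IRR rows at `k ≥ 4`
  (`λ = 6, 7`); (ii) (Λ)'s SPLIT clause carries the memo's exemption — `λ = 0` only when `W(K_k)` has no 3-torsion,
  `λ ∈ [−1, 1]` when both lines are `K_k`-rational (the 7 held-out SPLIT curves; for a split `χ ⊕ ωχ⁻¹` with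
  `μ₃ ⊂ K_k` the two lines are rational together or not at all) — the offer's "SPLIT ⇒ λ = 0" would be a statement
  refuted by P-KF4's own rows; (iii) twist covariance is typed over the tree's `quadraticTwist (-3)` (as
  `O5.CongruenceNumberTwistJumpAtNine`), the Kodaira flip II ↔ IV*, IV ↔ II* NOT asserted (only `starred` is read).

## KERNEL / VERDICT STATUS (cc-typer-5 GEN 10 restamp 1, 2026-08-21T23:10Z; statements byte-identical, tags unchanged)

* **(CAN) `LocIrrThreeJInvariant` IS A THEOREM — `O6.locIrrThreeJInvariant_holds : LocIrrThreeJInvariant`** (cross-cell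
  pool hand x11b3-p9 GEN 12, `O6/LocIrrThreeJInvariantHolds.lean` p304364 e2ab9b3ac82c; this lane's first refusal: no
  objection). Route ≠ the Katz–Lubin sketch below (which stays the EXPLANATION): the CLASS-FREE, MODEL-FREE lemma
  `Additive.padicValRat_j_eq_three_of_locIrr_three (W) [W.IsElliptic] : LocIrr W 3 → padicValRat 3 W.j = 3` from
  L-O56-sel (`locIrr_three_iff_locIrrCriterionThree`, THEOREM) + `padicValRat_Δ_of_locIrrCriterionThree`
  (`v₃Δ = 3·v₃c₄ − 3`) + `j = c₄³/Δ`; also `not_locIrr_three_of_padicValRat_j_ne_three`, `j_ne_zero_of_locIrr_three`,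
  `not_potMult_three_of_locIrr_three`, and `O6.not_locIrr_three_of_padicValRat_j_ne'` = this file's corollary with the
  (CAN) binder discharged. Tag KEPT (cc-lead ⟦gen28⟧ (7): a proved node keeps `@[conjecture]`, its proof is the
  audit's proof-of-item). Census 21/21 · 89/89 stays EVIDENCE; nothing booked; no mark.
* **(IRR) P-KF3 SMOKE = EXACT** (o6-r1 GEN 13 memo `gen13/O6-GEN13.md` §6, j138242): 459a1 (3,II) `(λ⁺₄, λ⁻₄) = (7, 6)`,
  1080b1 (3,IV*) `(6, 7)` — the pre-registered `{6, 7}` WITH the side rule (scorer IRRset / IRRside / INSTR / S4 / P4 / U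
  2/2); shards j138308–14 pending (fold rule G12-LATE §L2; a KILL there tombstones `IrrPairLawThree`). EVIDENCE.
* **(M), (Λ), (TW)**: no new verdict. **(AN) of the sibling file was REFUTED-AS-STATED on the held-out P-AN4 (AN-1) and is
  tombstoned there; the floor inequality `ν ≥ 𝔪` (B-facing AN-2) PASSED 474/474** — see `O6/KatoLocalFloorAnalytic.lean`.

References (printed antecedents, memo §0.3 / §5): M. Kurihara, Invent. Math. 149 (2002) Prop. 1.2, Prop. 2.1, Rem. 1.3
[Kurihara2002] (the floor is the wild analogue of the norm-index lemma; control identity on 17a1: `𝔪⁺_2 = 𝔪⁺_3 = 1/3 =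
q_n/φ(3^n)`); K. Kato, Astérisque 295 (2004) Thm. 12.5 [Kato2004Asterisque]; S. Kobayashi, Invent. Math. 152 (2003)
Prop. 8.12 [Kobayashi2003]; B. Mazur, J. Tate, Duke Math. J. 54 (1987) §1 [MazurTate1987]; A. Lei, R. Pollack, N. Pratap,
arXiv:2412.16629 §4.3 Ex. 4.8, Conj. 4.11 [LeiPollackPratap2024]; M. Hazewinkel, J. Algebra 32 (1974) Thm 6.1 and M. Kuriya,
J. Number Theory 113 (2005) Thm 1.1/1.4 (norm indices of formal groups over ramified bases; no bib keys, cited in prose);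
N. Katz, *p-adic properties of modular schemes and modular forms* (1973) Thm 3.10.7 and J. Lubin, Trans. AMS 251 (1979)
(canonical subgroups; prose). Galaxy / corpus presearch by o6-r1 (memo §5): no wild-`3` lattice-position law in print.
-/

set_option autoImplicit false

noncomputable section

open scoped Classical

open WeierstrassCurve Literature.NumberTheory.EllipticCurves
  Literature.NumberTheory.EllipticCurves.Rank1Residual
  Literature.NumberTheory.EllipticCurves.Rank1Residual.Typed
  Summit.BirchSwinnertonDyer.Rank1Residual.Additive

open Literature.NumberTheory.DiophantineGeometry (KodairaSymbol)

namespace Summit.BirchSwinnertonDyer.Rank1Residual.O6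

/-! ## §1 Pure arithmetic: `φ(3^k)`, the new-pole order `p(cell)`, the level `ℓ(cell)`, `𝔪` and `λ` from `n` -/

/-- `φ(3^k) = 2·3^{k−1}` (`k ≥ 1`; closed form, `= Nat.totient (3^k)` by `phiThree_eq_totient`). [folklore] -/
def phiThree (k : ℕ) : ℕ := 2 * 3 ^ (k - 1)

/-- `phiThree k = φ(3^k)` for `k ≥ 1`. [folklore] -/
theorem phiThree_eq_totient (k : ℕ) (hk : 1 ≤ k) : phiThree k = Nat.totient (3 ^ k) := by
  rw [phiThree, Nat.totient_prime_pow Nat.prime_three (by omega)]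
  norm_num [mul_comm]

/-- `phiThree k ≠ 0`. [folklore] -/
theorem phiThree_ne_zero (k : ℕ) : (phiThree k : ℚ) ≠ 0 := by
  have : 0 < phiThree k := by unfold phiThree; positivity
  exact_mod_cast this.ne'

/-- **The NEW-POLE ORDER `p(v₃N, Kod₃)`** (o6-r1 memo §2, C-O6-G12-M): the conjectured `3`-adic pole order of
the most polar SIGNED TRACE-FREE point of the log lattice, a function of the cell alone — `(3,II) 0 · (3,IV) 0 ·
(3,IV*) ½ · (3,II*) ½ · (4,II) 0 · (4,IV) ⅓ · (4,IV*) ½ · (4,II*) ⅚ · (5,II) ⅙ · (5,IV) ⅓ · (5,IV*) ⅔ · (5,II*) ⅚`;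
junk `0` off the twelve O6 cells. The irreducible local residue of O6 (Iwasawa side) is "three numbers and two
zeros": `x(A,·) = 0, x(B,II) = 0, x(B,IV) = ⅓, x(C,II) = ⅙, x(C,IV) = ⅓`, the starred half being `+ ½` (TL-1 / L3).
Typed through its numerator over `6` (`sixNewPoleOrder`, a table of naturals, one column per class). [folklore] -/
def sixNewPoleOrderA : KodairaSymbol → ℕ
  | .IVstar => 3 | .IIstar => 3 | _ => 0

/-- `6·p` on class B (`v₃N = 4`). [folklore] -/
def sixNewPoleOrderB : KodairaSymbol → ℕ
  | .IV => 2 | .IVstar => 3 | .IIstar => 5 | _ => 0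

/-- `6·p` on class C (`v₃N = 5`). [folklore] -/
def sixNewPoleOrderC : KodairaSymbol → ℕ
  | .II => 1 | .IV => 2 | .IVstar => 4 | .IIstar => 5 | _ => 0

/-- `6·p(v₃N, Kod₃)`; junk `0` off `v₃N ∈ {3, 4, 5}`. [folklore] -/
def sixNewPoleOrder (f : ℕ) (K : KodairaSymbol) : ℕ :=
  if f = 3 then sixNewPoleOrderA K else if f = 4 then sixNewPoleOrderB K
  else if f = 5 then sixNewPoleOrderC K else 0

/-- `p(cell) = sixNewPoleOrder / 6 ∈ {0, 1/6, 1/3, 1/2, 2/3, 5/6}` (see `sixNewPoleOrder`). [folklore] -/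
def newPoleOrder (f : ℕ) (K : KodairaSymbol) : ℚ := (sixNewPoleOrder f K : ℚ) / 6

/-- `6·p(cell) ≤ 5`. [folklore] -/
theorem sixNewPoleOrder_le (f : ℕ) (K : KodairaSymbol) : sixNewPoleOrder f K ≤ 5 := by
  unfold sixNewPoleOrder
  split_ifs <;> cases K <;> simp [sixNewPoleOrderA, sixNewPoleOrderB, sixNewPoleOrderC]

/-- **The cell LEVEL `ℓ(cell) = ½ + p(cell)`** (gen-11 KL-c table: `(3,·) ½ ½ 1 1 · (4,·) ½ ⅚ 1 4/3 · (5,·) ⅔ ⅚ 7/6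
4/3`). [folklore] -/
def cellLevel (f : ℕ) (K : KodairaSymbol) : ℚ := 1 / 2 + newPoleOrder f K

/-- The twelve values of the level table. [folklore] -/
theorem cellLevel_table :
    cellLevel 3 .II = 1 / 2 ∧ cellLevel 3 .IV = 1 / 2 ∧ cellLevel 3 .IVstar = 1 ∧ cellLevel 3 .IIstar = 1 ∧
    cellLevel 4 .II = 1 / 2 ∧ cellLevel 4 .IV = 5 / 6 ∧ cellLevel 4 .IVstar = 1 ∧ cellLevel 4 .IIstar = 4 / 3 ∧
    cellLevel 5 .II = 2 / 3 ∧ cellLevel 5 .IV = 5 / 6 ∧ cellLevel 5 .IVstar = 7 / 6 ∧ cellLevel 5 .IIstar = 4 / 3 := by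
  simp only [cellLevel, newPoleOrder, sixNewPoleOrder, sixNewPoleOrderA, sixNewPoleOrderB, sixNewPoleOrderC]
  norm_num

/-- **Twist covariance of the table (the DERIVED half of C-O6-G12-M, memo L3 (a)):** on every O6 class
`v₃N ∈ {3, 4, 5}`, `p(IV*) = p(II) + ½` and `p(II*) = p(IV) + ½` — the primitive residues are `p(·,II), p(·,IV)`
only. [folklore] -/
theorem newPoleOrder_starred (f : ℕ) (hf : f = 3 ∨ f = 4 ∨ f = 5) :
    newPoleOrder f .IVstar = newPoleOrder f .II + 1 / 2 ∧
      newPoleOrder f .IIstar = newPoleOrder f .IV + 1 / 2 := by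
  rcases hf with rfl | rfl | rfl <;>
    norm_num [newPoleOrder, sixNewPoleOrder, sixNewPoleOrderA, sixNewPoleOrderB, sixNewPoleOrderC]

/-- On the cyclic class B (`v₃N = 4`) the level is GEN 3's Kodaira offset `kodairaOffset (v₃Δ_min)` of
`O6/TowerInterfaces.lean` at the four Kodaira values `v₃Δ_min = 4, 6, 10, 12` (II, IV, IV*, II*): one law, two
formulations agree. [folklore] -/
theorem cellLevel_four_eq_kodairaOffset :
    cellLevel 4 .II = kodairaOffset 4 ∧ cellLevel 4 .IV = kodairaOffset 6 ∧
      cellLevel 4 .IVstar = kodairaOffset 10 ∧ cellLevel 4 .IIstar = kodairaOffset 12 := by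
  refine ⟨?_, ?_, ?_, ?_⟩ <;>
    norm_num [cellLevel, newPoleOrder, sixNewPoleOrder, sixNewPoleOrderB, kodairaOffset]

/-- `6·p(cell)` is a natural number `≤ 5` (so `φ(3^k)·p ∈ ℤ` for `k ≥ 2`). [folklore] -/
theorem exists_newPoleOrder_eq (f : ℕ) (K : KodairaSymbol) : ∃ m : ℕ, m ≤ 5 ∧ newPoleOrder f K = (m : ℚ) / 6 :=
  ⟨sixNewPoleOrder f K, sixNewPoleOrder_le f K, rfl⟩

/-- **THEOREM S1 as a definition: the SHARP KATO-LOCAL FLOOR from the lattice position**, `𝔪 = ½ − n/φ(3^k)`.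
[folklore] -/
def floorOf (n : ℤ) (k : ℕ) : ℚ := 1 / 2 - (n : ℚ) / (phiThree k : ℚ)

/-- **`λ := −(n + φ(3^k)·p(cell))`** — the integer "module defect" of C-O6-G12-M (`= φ(3^k)·(𝔪 − ℓ(cell))`,
`lamOf_eq_phiThree_mul`). [folklore] -/
def lamOf (f : ℕ) (K : KodairaSymbol) (n : ℤ) (k : ℕ) : ℚ :=
  -((n : ℚ) + (phiThree k : ℚ) * newPoleOrder f K)

/-- `λ = φ(3^k)·(𝔪 − ℓ)`. [folklore] -/
theorem lamOf_eq_phiThree_mul (f : ℕ) (K : KodairaSymbol) (n : ℤ) (k : ℕ) :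
    lamOf f K n k = (phiThree k : ℚ) * (floorOf n k - cellLevel f K) := by
  have h := phiThree_ne_zero k
  unfold lamOf floorOf cellLevel
  field_simp
  ring

/-- **S4 integrality for free: `λ ∈ ℤ` for `k ≥ 2`** (memo §0.1: 678/678 + 240/240 rows, 0 non-integral — here a
one-line consequence of `n ∈ ℤ` and `6 ∣ φ(3^k)`). [folklore] -/
theorem exists_lamOf_eq_int (f : ℕ) (K : KodairaSymbol) (n : ℤ) (k : ℕ) (hk : 2 ≤ k) :
    ∃ l : ℤ, lamOf f K n k = l := by
  obtain ⟨m, -, hm⟩ := exists_newPoleOrder_eq f K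
  obtain ⟨j, rfl⟩ : ∃ j, k = j + 2 := ⟨k - 2, by omega⟩
  refine ⟨-(n + 3 ^ j * m), ?_⟩
  rw [lamOf, hm, phiThree, show j + 2 - 1 = j + 1 from rfl]
  push_cast
  ring

/-- `⌊A_k⌋` with `A_k = (3^{k−1} − 1)/4` (ℕ-division is the floor): `0, 0, 2, 6, 20, 60` for `k = 1, …, 6` — the IRR
minimum of C-O6-G12-IRR / (AN). [folklore] -/
def irrFloor (k : ℕ) : ℕ := (3 ^ (k - 1) - 1) / 4

/-- The IRR minima at `k = 2, …, 6` (analytic levels of memo §2 and the P-KF3 prediction `{6, 7}`). [folklore] -/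
theorem irrFloor_values : irrFloor 2 = 0 ∧ irrFloor 3 = 2 ∧ irrFloor 4 = 6 ∧ irrFloor 5 = 20 ∧ irrFloor 6 = 60 := by
  decide

/-- Kodaira types IV* and II* are the STARRED members of the `ε₋₃`-orbits {II, IV*}, {IV, II*}. [folklore] -/
def starred : KodairaSymbol → Bool
  | .IVstar => true | .IIstar => true | _ => false

/-! ## §2 Interface: the signed floor datum of a curve (definition request D-O6-KF) -/

/-- **The SHAPE of `W[3]|G_{ℚ₃}`** (o6-r1 gen 10 V10-SHAPE): `ET1` = a `ℚ₃`-rational point of order `3` (a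
`G_{ℚ₃}`-stable line with trivial character), `ETM` = its unramified-quadratic twist, `ORD1` = `μ₃ ⊂ W[3]`, `ORDM` =
twist, `SPLIT` = semisimple split `χ ⊕ ωχ⁻¹`, `IRR` = irreducible (`= LocIrr W 3`, see `ReadsLocIrr`). An interface
code (Mathlib has the objects but not the classification as a function); nothing asserted. [folklore] -/
inductive LocalShapeThree
  | ET1 | ETM | ORD1 | ORDM | SPLIT | IRR
  deriving DecidableEq, Repr

/-- The TORSION SIGN `s_T` of a shape: `ET1` torsion is `c`-even (`some true`), `ORD1` (`μ₃`) is `c`-odd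
(`some false`); no rational line of definite sign otherwise. [folklore] -/
def LocalShapeThree.torsSign : LocalShapeThree → Option Bool
  | .ET1 => some true | .ORD1 => some false | _ => none

/-- The `ε₋₃`-twist on shapes (ET ↔ ORD, `s_T` flips; IRR, SPLIT fixed) — memo L3. [folklore] -/
def LocalShapeThree.twist : LocalShapeThree → LocalShapeThree
  | .ET1 => .ORD1 | .ORD1 => .ET1 | .ETM => .ORDM | .ORDM => .ETM | .SPLIT => .SPLIT | .IRR => .IRR

/-- **D-O6-KF (interface): the signed Kato-local floor datum of `W` at `3`.** For `W ∈ O6`, `k ≥ 1`, `s = ±`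
(`true` = even): `pos k s = n^s_k(W) ∈ ℤ`, the `ϖ`-position of the signed trace-free log lattice `Λ^s_k(W) =
ϖ^{n}·𝒪^{new,s}` (THEOREM S1/S3 of the memo make it well defined: every `G`-stable lattice in the rank-one
`𝒪_χ`-module `K_k^{new,s}` is `ϖ^n 𝒪^{new,s}`); `nu k s = ν^s_k(W)`, the `3`-adic valuation of the `χ_s`-part of the
Mazur–Tate element `θ_{k+1}(W)` (`v₃(τ(χ̄)L(W,χ̄,1)/Ω)`-normalised as in gens 9–11; the same number for every `χ_s` of
conductor `3^{k+1}` and sign `s`; `none` iff it vanishes); `katoConst = v₃(c_W)` (Manin constant × Kato's image index);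
`shape` = the shape of `W[3]|G_{ℚ₃}`; `torsThree k = v₃ #W(K_k)[3^∞]` (= the saturation defect `satdef` of the
audit j136654, memo §4). The structure only NAMES the datum (instrument `katofloor_v2.gp` sha16 `282dcd27a57d38d5`
computes it); that it exists and is unique is the separate construction shape `SignedFloorDatum.RealisedShape`;
compatibility with the tree's `LocIrr` is `ReadsLocIrr`. [cite: MazurTate1987, §1] [cite: Kurihara2002, Prop. 1.2 and Prop. 2.1] -/
structure SignedFloorDatum (W : WeierstrassCurve ℚ) where
  /-- `n^s_k(W)`: `ϖ`-position of `Λ^s_k(W) = L_k(W) ∩ K_k^{new,s}`. -/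
  pos : ℕ → Bool → ℤ
  /-- `ν^s_k(W)`; `none` iff the `χ_s`-part of `θ_{k+1}(W)` vanishes. -/
  nu : ℕ → Bool → Option ℚ
  /-- `v₃(c_W)`, Kato's constant. -/
  katoConst : ℕ
  /-- shape of `W[3]|G_{ℚ₃}`. -/
  shape : LocalShapeThree
  /-- `v₃ #W(K_k)[3^∞]`, `K_k = ℚ₃(μ_{3^{k+1}})`. -/
  torsThree : ℕ → ℕ

namespace SignedFloorDatum

variable {W : WeierstrassCurve ℚ}

/-- `𝔪^s_k(W) = ½ − n^s_k(W)/φ(3^k)` (THEOREM S1 as the reading of the datum). [folklore] -/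
def floor (D : SignedFloorDatum W) (k : ℕ) (s : Bool) : ℚ := floorOf (D.pos k s) k

/-- `λ^s_k(W) = −(n^s_k + φ(3^k)·p(v₃N_W, Kod₃(W)))` read on the cell of `W` (tree columns `condExp W 3`,
`W.kodairaSymbolAt (placeOf 3)`). [folklore] -/
def lam [W.IsElliptic] [W.IsGloballyMinimal] (D : SignedFloorDatum W) (k : ℕ) (s : Bool) : ℚ :=
  lamOf (condExp W 3) (W.kodairaSymbolAt (placeOf 3)) (D.pos k s) k

/-- **Compatibility with the tree's Fouquet–Wan bit:** the datum's shape code reads `IRR` iff `ρ̄_{W,3}|G_{ℚ₃}` is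
irreducible (`LocIrr W 3`, `Additive/FouquetWanLocus.lean`). A predicate; `real W D` is expected to entail it.
[folklore] -/
def ReadsLocIrr [W.IsElliptic] [W.IsGloballyMinimal] (D : SignedFloorDatum W) : Prop :=
  D.shape = .IRR ↔ LocIrr W 3

end SignedFloorDatum

/-- **CONSTRUCTION shape for D-O6-KF** (hypothesis schema over the interface predicate `real`, not a conjecture
node): on O6 the signed floor datum exists and is unique. Nothing asserted. [folklore] -/
def SignedFloorDatum.RealisedShape
    (real : ∀ (W : WeierstrassCurve ℚ) [W.IsElliptic] [W.IsGloballyMinimal], SignedFloorDatum W → Prop) : Prop :=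
  ∀ (W : WeierstrassCurve ℚ) [W.IsElliptic] [W.IsGloballyMinimal], ClassO6 W 3 → ∃! D : SignedFloorDatum W, real W D

/-! ## §3 The local laws of T-O6-G12 (o6-r1 GEN 12; `@[conjecture]` nodes over `real`; EVIDENCE-labelled) -/

section Laws

variable (real : ∀ (W : WeierstrassCurve ℚ) [W.IsElliptic] [W.IsGloballyMinimal], SignedFloorDatum W → Prop)

/-- **(M) MODULE-STRUCTURE LAW C-O6-G12-M (CONJECTURE; KILLABLE; EVIDENCE-labelled; statement discovery with a
PASSED held-out).** For `W ∈ O6`, `k ≥ 2`, `s = ±`, shape NOT IRR: `Λ^s_k(W) = ϖ^{−2·3^{k−1}·p(cell) − λ}·𝒪^{new,s}`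
with the INTEGER `λ = λ^s_k(W) ∈ [−1, 2]` (`λ = 0` on the majority of rows; memo §2; the valuation form: "the most
polar signed trace-free point has a log-pole of `3`-adic order `p(cell) + 3λ/e_k`"). `λ(IRR)` is governed by
`IrrPairLawThree`, not by this bound (typer decision (i), memo §5 (M) verbatim). Why it might fail: a cell whose pole
order is not constant, or a `|λ| > 2` row (the k = 1 layer IS off-law and excluded). PRE-REGISTERED KILL (gen-11
`gen11/kf/PKF4-PREREG.md` sha16 `e42f582ff7f8181f`, P1): one `(W, k ≥ 2, s)` with `λ ∉ ℤ ∩ [−2, 2]` — P-KF4 0/480.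
[evidence: census cell O6, o6-r1 GEN 11/12: P-KF1/2 1 356 (curve, k, sign) rows N ≤ 10⁴ (285 island curves), λ ∈ ℤ ∩ [−2,2] 0 exceptions, λ ≥ −1 678/678; HELD-OUT P-KF4 (120 curves 10⁴ < N ≤ 4·10⁴, 10 per cell, k ∈ {2,3}, 480 signed rows; instrument katofloor_v2.gp 282dcd27a57d38d5, input 0e734c5841582ea4, jobs j136696–8, verdict gen12/kf4/PKF4-VERDICT.md 5eb6e3be3933f763): P1 0/480, P2 24/24, P4 0 negatives, S4 480/480, λ ≥ −1 480/480 — PASS, 0 exceptions]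
[cite: Kurihara2002, Prop. 2.1 (norm index ≥ q_n via Hazewinkel)] [cite: Kobayashi2003, Prop. 8.12] -/
@[conjecture] def ModuleStructureLawThree : Prop :=
  ∀ (W : WeierstrassCurve ℚ) [W.IsElliptic] [W.IsGloballyMinimal] (D : SignedFloorDatum W),
    ClassO6 W 3 → real W D → D.shape ≠ .IRR →
      ∀ (k : ℕ) (s : Bool), 2 ≤ k → -1 ≤ D.lam k s ∧ D.lam k s ≤ 2

/-- **(Λ) SHAPE / TORSION LAW C-O6-G12-Λ (CONJECTURE; KILLABLE; EVIDENCE-labelled; found in the gen-11 FINAL table,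
then PRE-REGISTERED for the held-out set BEFORE its results were read, `gen12/kf4/PKF4-SHAPE-PREREG.md` sha16
`e8df1cb1baceb2bb`).** For `W ∈ O6` and `k ≥ 3`, the integer `λ` is a TORSION / SHAPE invariant, not noise: shape
`ETM` or `ORDM` (no `K_k`-rational 3-torsion) ⟹ `(λ⁺, λ⁻) = (0, 0)`; `SPLIT` with `W(K_k)[3] = 0` ⟹ `(0, 0)`, with both
lines `K_k`-rational ⟹ `λ ∈ [−1, 1]` per sign (the 7 held-out SPLIT curves, superpositions of the two torsion
effects); `ET1` (`T ∈ W(ℚ₃)[3]`, `cT = +T`, `s_T = +`) resp. `ORD1` (`μ₃ ⊂ W[3]`, `s_T = −`) ⟹ `λ^{s_T} ∈ {−1, 0}` and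
`λ^{−s_T} ∈ {1, 2}` (modal `(−1, +1)`), and `λ^{s_T} = −1` WITHOUT EXCEPTION in classes B, C (`v₃N ≠ 3`). Mechanism
(conjectural, Q-O6-G12-4): `K_k`-rational 3-torsion of sign `s_T` moves one `ϖ`-step from the `s_T`-isotypic
trace-free lattice to the other (3-isogeny index calculus). Why it might fail: a held-out row with ETM/ORDM and
`λ ≠ 0` at `k ≥ 3`, or a class-B/C torsion curve with `λ^{s_T} = 0`. The `k = 2` layer is NOT covered (class-A
`v₃(j) = 3` ETM/ORDM rows read `(0,1) | (1,0)` there).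
[evidence: census cell O6, o6-r1 GEN 11 FINAL k = 3, 285 curves: ETM/ORDM (0,0) 128/128, SPLIT (no torsion) (0,0) 20/20, ET1 56/56 and ORD1 60/60 in the stated sets (modal (−1,+1) 73/116), λ^{s_T} = −1 on classes B, C 72/72; HELD-OUT P-KF4 (shapes computed from a-invariants before the run: ET1 25, ETM 28, ORD1 24, ORDM 29, IRR 7, SPLIT 7): SP1 57/57, SP2 49/49, SP2b 35/35, SP4 0/0 (all 7 SPLIT curves satdef = 2, exempt, λ ∈ [−1,1]²), SP5 0 violations, SP6 480/480 — PASS, 0 exceptions; saturation audit j136654: satdef = v₃#W(K_k)[3^∞] exactly on the ET1/ORD1 curves, lattice saturated 20/20] -/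
@[conjecture] def ShapeTorsionLawThree : Prop :=
  ∀ (W : WeierstrassCurve ℚ) [W.IsElliptic] [W.IsGloballyMinimal] (D : SignedFloorDatum W),
    ClassO6 W 3 → real W D → ∀ (k : ℕ), 3 ≤ k →
      ((D.shape = .ETM ∨ D.shape = .ORDM) → ∀ s, D.lam k s = 0) ∧
      (D.shape = .SPLIT → D.torsThree k = 0 → ∀ s, D.lam k s = 0) ∧
      (D.shape = .SPLIT → D.torsThree k ≠ 0 → ∀ s, -1 ≤ D.lam k s ∧ D.lam k s ≤ 1) ∧
      (∀ sT, D.shape.torsSign = some sT →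
        (D.lam k sT = -1 ∨ D.lam k sT = 0) ∧ (D.lam k (!sT) = 1 ∨ D.lam k (!sT) = 2) ∧
        (condExp W 3 ≠ 3 → D.lam k sT = -1))

/-- **(IRR) PAIR LAW C-O6-G12-IRR (CONJECTURE; KILLABLE; EVIDENCE-labelled).** For `W ∈ O6` with `W[3]|G_{ℚ₃}`
IRREDUCIBLE (only in class A with `v₃(j) = 3`, `LocIrrThreeJInvariant`) and `k ≥ 2`: `{λ⁺_k, λ⁻_k} = {⌊A_k⌋, ⌈A_k⌉}`
with `A_k = (3^{k−1} − 1)/4` — i.e. `λ⁺ + λ⁻ = (3^{k−1} − 1)/2` and both `≥ ⌊A_k⌋` (`= irrFloor k`), hence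
`𝔪⁺_k + 𝔪⁻_k = 2ℓ + Σ_{m=2}^{k} 1/φ(3^m)` (ONE level-`m` unit per layer — the signature of a norm defect of index `3`
per layer of the formal-group tower, Hazewinkel 1974 / Kuriya 2005) and `𝔪^s_k − ℓ → 1/8 = v₃` of the nonzero
`3`-torsion of a height-2 formal group WITHOUT canonical subgroup (L-O6-G12-CAN: IRR ⟹ `v(Hasse) ≥ 3/4`, single
slope); the odd unit at EVEN `k` sits on `+` for cell `(3, II)` and on `−` for `(3, IV*)` (= twist covariance). Why
it might fail: P-KF3 (k = 4, pre-registered `gen12/kf3/PKF3-PREREG.md` sha16 `b7ed5d8a802ef54c`, jobs j138308–14):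
KILL if `λ_4 = (2,2)` or `min_s λ^s_4 ≠ 6` on an IRR curve with the instrument OK. STATUS (GEN 10 restamp 1): P-KF3
SMOKE j138242 EXACT — 459a1 (3,II) `(λ⁺₄, λ⁻₄) = (7, 6)`, 1080b1 (3,IV*) `(6, 7)`, sides as pre-registered (o6-r1 GEN 13
§6); shards pending.
[evidence: census cell O6, o6-r1 GEN 11/12: algebraic k = 2 {0,1} 21/21 (odd unit on + for (3,II), on − for (3,IV*)), k = 3 (2,2) 21/21, held-out 7/7 + 7/7 (SP3); analytic (exact θ-tables gen12/an/an_levels_k2-6.txt 3e340d471769bdb1): min_s a^s_k = 2, 6, 20, 60 at k = 3..6 on 21/21, 18/21, 21/21, 14/16 curves, a^s_k ≥ ⌊A_k⌋ 158/158 rows, Σ_s a^s_k ≥ (3^{k−1}−1)/2 on 21/21 ×3 + 16/16] -/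
@[conjecture] def IrrPairLawThree : Prop :=
  ∀ (W : WeierstrassCurve ℚ) [W.IsElliptic] [W.IsGloballyMinimal] (D : SignedFloorDatum W),
    ClassO6 W 3 → real W D → D.shape = .IRR → ∀ (k : ℕ), 2 ≤ k →
      D.lam k true + D.lam k false = ((3 ^ (k - 1) - 1 : ℕ) : ℚ) / 2 ∧
      (irrFloor k : ℚ) ≤ D.lam k true ∧ (irrFloor k : ℚ) ≤ D.lam k false ∧
      (W.kodairaSymbolAt (placeOf 3) = .II → D.lam k false = irrFloor k) ∧
      (W.kodairaSymbolAt (placeOf 3) = .IVstar → D.lam k true = irrFloor k)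

/-- **(TW) TWIST COVARIANCE T-O6-TW (THEOREM-CANDIDATE with proof sketch; `@[conjecture]` until a kernel proof;
EVIDENCE-labelled).** For `W ∈ O6` and `W′` a globally minimal model of `W ⊗ ε₋₃` (same `j`, same `N`; Kodaira at `3`
II ↔ IV*, IV ↔ II*; shape ET ↔ ORD with `s_T` flipped, IRR / SPLIT fixed): `𝔪^±_k(W′) = 𝔪^∓_k(W) + ½` from an
unstarred to a starred type (`− ½` the other way), equivalently `λ^±_k(W′) = λ^∓_k(W)` with `p(cell*) = p(cell) + ½`
(`newPoleOrder_starred`). Sketch (memo L3): `√−3 ∈ K_k`, so `W′ ≅ W` over `K_k`, the isomorphism multiplying the formal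
logarithm by `√−3` (`v = ½`) and intertwining `σ` up to `ε₋₃(σ)`; `ε₋₃(−1) = −1` swaps the `(−1)`-eigenspaces:
`Λ^±(W′) = √−3·Λ^∓(W)`. Only `starred (Kod₃ W)` is read; the Kodaira flip itself is NOT asserted here.
[evidence: census cell O6, o6-r1 GEN 11 FINAL k = 1,2,3: 117 genuine ε₋₃-pairs, 270/270 signed rows swap exactly (ET1/ORD1 110, ETM/ORDM 123, IRR 21, SPLIT 16); the 3 non-swapping kod-flipped pairs at 25 ∥ N are ε₋₃·χ₅-twists, not ε₋₃-twists] -/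
@[conjecture] def TwistCovarianceLawThree : Prop :=
  ∀ (W W' : WeierstrassCurve ℚ) [W.IsElliptic] [W.IsGloballyMinimal] [W'.IsElliptic] [W'.IsGloballyMinimal]
    (C : VariableChange ℚ) (D : SignedFloorDatum W) (D' : SignedFloorDatum W'),
    C • W.quadraticTwist (-3) = W' → ClassO6 W 3 → real W D → real W' D' →
      D'.shape = D.shape.twist ∧
      ∀ (k : ℕ) (s : Bool), 1 ≤ k →
        D'.floor k (!s) = D.floor k s + (if starred (W.kodairaSymbolAt (placeOf 3)) then -(1 / 2) else 1 / 2)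

end Laws

/-- **(CAN) L-O6-G12-CAN: local irreducibility forces `v₃(j) = 3` on O6 (THEOREM-CANDIDATE, proof sketch of o6-r1
GEN 12 LATE L1; `@[conjecture]` until a kernel proof; EVIDENCE-labelled; no datum, tree predicates only).** For `W`
wild potentially good at `3` (`ClassO6 W 3`): `ρ̄_{W,3}|G_{ℚ₃}` irreducible (`LocIrr W 3`) ⟹ `v₃(j(W)) = 3`. Sketch:
over a field `L/ℚ₃` of good reduction take `y² = x³ + a₂x² + a₄x + a₆`, `b := a₂` (the Hasse invariant in
characteristic `3`); Katz 1973 Thm 3.10.7 / Lubin 1979: `Ê_L[3]` has a CANONICAL SUBGROUP iff `v(b) < 3/4`, else all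
eight nonzero points sit at valuation `1/8`; a unit discriminant with `v(a₂) > 0` forces `v(a₄) = 0`, whence
`v(b) < ½ ⟹ v₃(j) = 6v(b)`, `v(b) > ½ ⟹ v₃(j) = 3`, `v₃(j) > 3 ⟹ v(b) = ½`; so `v₃(j) ≠ 3 ⟹ v(b) ≤ ½ < ¾ ⟹` a
canonical subgroup, which is `G_{ℚ₃}`-stable (uniqueness of the good model up to `𝒪_L`-isomorphism) ⟹ REDUCIBLE.
Inside `(v₃N, v₃j) = (3, 3)` the lemma is silent (21 IRR / 36 reducible). It is the wild twin of GEN 9's tame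
canonical-subgroup criterion at `p ≥ 5` (`Additive/LocIrrValuationCriterionTame.lean`) and sharpens Q-O6-G12-5.
**PROVED 2026-08-21 (kernel): `O6.locIrrThreeJInvariant_holds`** (x11b3-p9 GEN 12, `O6/LocIrrThreeJInvariantHolds.lean`
p304364) — indeed `LocIrr W 3 → v₃(j) = 3` for EVERY elliptic curve over `ℚ`, any model
(`Additive.padicValRat_j_eq_three_of_locIrr_three`, via L-O56-sel); statement byte-identical; tag kept; census EVIDENCE.
[evidence: census cell O6, o6-r1 GEN 11/12 (285 island curves): IRR ⟹ (v₃N, v₃j) = (3,3) 21/21; v₃j ∈ {1,2} ⟹ reducible 89/89; no IRR in class C (v₃j ≥ 4) or class A with v₃j ∈ {6,9}]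
[cite: SerreInventiones1972, §1 (formal group of height 2)] -/
@[conjecture] def LocIrrThreeJInvariant : Prop :=
  ∀ (W : WeierstrassCurve ℚ) [W.IsElliptic] [W.IsGloballyMinimal],
    ClassO6 W 3 → LocIrr W 3 → padicValRat 3 W.j = 3

/-- Contrapositive reading for the census columns: on O6, `v₃(j) ≠ 3 ⟹ ¬ LocIrr W 3`, granted (CAN) — now
unconditional as `O6.not_locIrr_three_of_padicValRat_j_ne'` / class-free `Additive.not_locIrr_three_of_padicValRat_j_ne_three`
(p304364). [folklore] -/
theorem not_locIrr_three_of_padicValRat_j_ne (h : LocIrrThreeJInvariant) (W : WeierstrassCurve ℚ) [W.IsElliptic]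
    [W.IsGloballyMinimal] (hO : ClassO6 W 3) (hj : padicValRat 3 W.j ≠ 3) : ¬ LocIrr W 3 :=
  fun hL ↦ hj (h W hO hL)

end Summit.BirchSwinnertonDyer.Rank1Residual.O6

end
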